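import Summits.HodgeConjecture.HodgeConjecture.Theses.SplitMonadSeeds
import Literature.AlgebraicGeometry.Motives.AbelianVarietyExistence
import Literature.AlgebraicGeometry.Motives.VarietiesDimensionProofs

/-!
# `SplitMonadSeeds.InnerFormAnchors` (stmt-HodgeConjecture-25517) — anchor dimension bookkeeping and the cohomology-free shadows of the Weil axioms, kernel-checked

Support item `InnerFormAnchors := ∀ A : AbelianVariety ℂ, PadicAnchor.InnerFormAnchorsFor A` of route
`HodgeConjecture/SplitMonadSeeds` is true in print (Kisin 2017, §2; Kisin–Madapusi Pera–Shin 2022) and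
construction-blocked as typed: an inner-form anchor contains a value
`C : CrystallineRealization p k ⊇ WeilCohomology k K(p, k)` over an algebraically closed field `k` of
characteristic `p > dim A + 6` (`Theorems/SplitMonadSeedsInnerFormAnchorsDebt`). This file records two
things for that debt:

1. **Anchor bookkeeping** (`anchor_dim_eq`, `anchor_dim_large`): the supersingular special-fibre abelian
   variety `D.A₀` of an anchor `D : Anchor n X` has `dim D.A₀ = n` and `dim D.A₀ + 6 < p` — `D.A₀.dim`
   is the Krull dimension of the special fibre of the model, which the model makes smooth projective of
   dimension `n`; discharged cohomology-free by the tree's PROVED `schemeDim_eq_holds`. Consumers of an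
   anchor that apply facts stated for `A₀ : AbelianVariety k` in terms of `A₀.dim` need exactly this.
2. **The cohomology-free shadows of the Weil axioms are already theorems of the tree** — the point of
   the consistency audit of the item (evidence `CONSISTENCY-AUDIT-25517.md`): a refutation `¬ InnerFormAnchors`
   could only come from a consequence of the axioms of `WeilCohomology` / `CrystallineRealization` whose
   statement mentions `k`-schemes alone and contradicts constructed geometry. The two such consequences
   the axioms (A) and (C-lite) yield are kernel-checked here from an arbitrary `W : WeilCohomology k K`:
   `eq_of_isSmoothProjective` (a Weil cohomology theory detects dimension: Poincaré duality `H²ᵐ(X) ≅ K`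
   against `Hⁱ(X) = 0` for `i > 2n`) and `finsum_residueDegree_eq_zero_of_mem_ratTrivial` (a Weil
   cohomology theory forces `∑_{codim z = n} c(z)·[κ(z):k] = 0` for every rationally trivial zero-cycle
   `c` on a compact smooth projective `n`-fold: `cycleMap_eq_zero_of_mem_ratTrivial`, linearity of the
   trace, `trace_cycleClass`, `cycleClass_eq_zero_of_coheight_ne`). Both are TRUE of the tree's real
   carriers and proved there without any cohomology — the first is `eq_of_isSmoothProjective'` below
   (`schemeDim_eq_holds`), the second is Fulton, Thm. 1.4 pushed to `Spec k` (the tree's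
   `map_mem_ratTrivial_holds`) — so neither can refute `Nonempty (WeilCohomology k K)`: the item is
   HELD for a construction, not in doubt, and not refutable from the geometry the tree has.

The corollaries `…_of_innerFormAnchorsFor` / `…_of_innerFormAnchors` restate the shadows as consequences
of the item (over the residue field of an anchor, resp. in arbitrarily large characteristic). Nothing here
asserts or refutes a Theses declaration; no definition, no named fact, no `sorry`. No summit statement,
rung or case of the Hodge conjecture is proved here.
-/

-- `Summit.HodgeConjecture.HodgeConjecture.…` repeats the summit name by the D-0017 layout (Sub = Summit), so the
-- dupNamespace linter is silenced for this file (CONVENTIONS §1).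
set_option linter.dupNamespace false

noncomputable section

open CategoryTheory AlgebraicGeometry
open scoped Isocrystal
open Literature.AlgebraicGeometry.Motives Literature.AlgebraicGeometry.Crystalline.PadicAnchor

namespace Summit.HodgeConjecture.HodgeConjecture.Theorems.SplitMonadSeeds.InnerFormAnchorsShadows

universe u v

section Weil

variable {k : Type u} [Field k] {K : Type v} [Field K] [CharZero K] {n m : ℕ} {X : SchemeOver k}

/-- **A Weil cohomology theory detects dimension.** If the `k`-scheme `X` is a smooth projective
variety of dimension `n` and also of dimension `m`, then `n = m`: otherwise, say `n < m`, axiom (A)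
makes `H²ᵐ(X)` both zero (`i > 2n`) and isomorphic to `K` via the trace. (Cohomology-free and already a
theorem of the tree: `eq_of_isSmoothProjective'`.) [folklore] -/
theorem eq_of_isSmoothProjective (W : WeilCohomology k K) (hn : IsSmoothProjective n X)
    (hm : IsSmoothProjective m X) : n = m := by
  by_contra hne
  wlog hlt : n < m generalizing n m
  · exact this hm hn (Ne.symm hne) (lt_of_le_of_ne (not_lt.mp hlt) (Ne.symm hne))
  haveI : Subsingleton (W.obj X (2 * m)) := W.subsingleton_obj hn (by omega)
  obtain ⟨x, hx⟩ := (W.bijective_trace hm).2 1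
  obtain ⟨y, hy⟩ := (W.bijective_trace hm).2 0
  exact one_ne_zero (hx.symm.trans ((congrArg (W.trace X m) (Subsingleton.elim x y)).trans hy))

/-- The same statement WITHOUT any cohomology, from the tree's proved `schemeDim_eq_holds` (a smooth
projective geometrically irreducible `k`-scheme of relative dimension `n` has Krull dimension `n`).
[folklore] -/
theorem eq_of_isSmoothProjective' (hn : IsSmoothProjective n X) (hm : IsSmoothProjective m X) :
    n = m :=
  (schemeDim_eq_holds hn).symm.trans (schemeDim_eq_holds hm)

/-- **A Weil cohomology theory forces the degree of a rationally trivial zero-cycle to vanish.** On a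
smooth projective `n`-fold `X` with compact underlying space, for every zero-cycle `c` rationally
equivalent to zero, `∑_{codim z = n} c(z) · [κ(z) : k] = 0`: the cycle map kills `c`
(`cycleMap_eq_zero_of_mem_ratTrivial`), the trace is linear, the class of a codimension-`n` point has
trace its residue degree (`trace_cycleClass`) and the other classes vanish
(`cycleClass_eq_zero_of_coheight_ne`). (True of the real carriers without cohomology: Fulton, Thm. 1.4
— the tree's `map_mem_ratTrivial_holds` — pushed forward to `Spec k`.) [folklore] -/
theorem finsum_residueDegree_eq_zero_of_mem_ratTrivial (W : WeilCohomology k K)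
    (hX : IsSmoothProjective n X) [CompactSpace X.left] (c : AlgebraicCycle X.left ℤ)
    (hc : c ∈ ratTrivial X.left 0) :
    ∑ᶠ z : X.left, (if Order.coheight z = (n : ℕ∞) then c z * (X.hom.residueDegree z : ℤ) else 0) = 0 := by
  have h0 : W.cycleMap X n c = 0 := W.cycleMap_eq_zero_of_mem_ratTrivial hX n 0 (by omega) c hc
  have htr : W.trace X n (W.cycleMap X n c) = 0 := by rw [h0, map_zero]
  have hfin := W.finite_support_cycleMap X n c
  rw [PreWeilCohomology.cycleMap, map_finsum _ hfin] at htr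
  have hterm : ∀ z : X.left, W.trace X n (c z • W.cycleClass X n z) =
      ((if Order.coheight z = (n : ℕ∞) then c z * (X.hom.residueDegree z : ℤ) else 0 : ℤ) : K) := by
    intro z
    by_cases hz : Order.coheight z = (n : ℕ∞)
    · rw [if_pos hz, map_zsmul, W.trace_cycleClass hX z hz, Int.cast_mul, Int.cast_natCast,
        zsmul_eq_mul]
    · rw [if_neg hz, W.cycleClass_eq_zero_of_coheight_ne hX n z hz, smul_zero, map_zero, Int.cast_zero]
  simp_rw [hterm] at htr
  have hfin' : (Function.support fun z : X.left =>
      (if Order.coheight z = (n : ℕ∞) then c z * (X.hom.residueDegree z : ℤ) else 0 : ℤ)).Finite := by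
    refine (show (Function.support c).Finite from ?_).subset ?_
    · simpa using c.locallyFiniteSupport.finite_inter_support_of_isCompact isCompact_univ
    · intro z hz
      rw [Function.mem_support] at hz ⊢
      intro hcz
      exact hz (by simp [hcz])
  have hcast := map_finsum (Int.castAddHom K) hfin'
  simp only [Int.coe_castAddHom] at hcast
  rw [← hcast] at htr
  exact_mod_cast htr

end Weil

/-! ### Anchor bookkeeping -/

/-- **The special-fibre abelian variety of an anchor has dimension `n`**: for an anchor `D` of a complex
`n`-fold, `dim D.A₀ = n` (`D.A₀.dim` is the Krull dimension `schemeDim` of `D.A₀.X`, which IS the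
special fibre of the model `D.𝒴` (`D.special_eq`), smooth projective of dimension `n`
(`D.model.isSmoothProjective_specialFibre`); conclude by the tree's `schemeDim_eq_holds`). [folklore] -/
theorem anchor_dim_eq {n : ℕ} {X : SchemeOver ℂ} (D : Anchor n X) : D.A₀.dim = n := by
  change schemeDim D.A₀.X.left = n
  rw [D.special_eq]
  exact schemeDim_eq_holds D.model.isSmoothProjective_specialFibre

/-- … hence the Bloch–Esnault–Kerz bound of the model holds for the special-fibre abelian variety in
its own terms: `dim D.A₀ + 6 < p`. [folklore] -/
theorem anchor_dim_large {n : ℕ} {X : SchemeOver ℂ} (D : Anchor n X) : D.A₀.dim + 6 < D.p := by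
  rw [anchor_dim_eq D]
  exact D.large

/-- … and `D.A₀.X` is smooth projective of dimension `n` (the model's special-fibre clause, re-indexed
along `D.special_eq`). [folklore] -/
theorem anchor_isSmoothProjective {n : ℕ} {X : SchemeOver ℂ} (D : Anchor n X) :
    IsSmoothProjective n D.A₀.X := by
  rw [D.special_eq]
  exact D.model.isSmoothProjective_specialFibre

/-! ### The shadows as consequences of the item -/

/-- **Shadow 1 of the item**: an inner-form anchor of `A` yields (through its Weil cohomology theory
`D.C`) invariance of dimension for smooth projective varieties over the anchor's residue field, an
algebraically closed field of some characteristic `p > dim A + 6`. [folklore] -/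
theorem eq_of_isSmoothProjective_of_innerFormAnchorsFor {A : AbelianVariety ℂ}
    (h : InnerFormAnchorsFor A) :
    ∃ (p : ℕ) (_ : Fact p.Prime) (k : Type) (_ : Field k) (_ : CharP k p) (_ : IsAlgClosed k),
      A.dim + 6 < p ∧ ∀ ⦃n m : ℕ⦄ ⦃X : SchemeOver k⦄,
        IsSmoothProjective n X → IsSmoothProjective m X → n = m := by
  obtain ⟨σ, 𝒳₀, S₀, f₀, t, s, eA, -, -, -, -, -, D, -, -⟩ := h
  exact ⟨D.p, D.prime, D.k, D.field, D.charP, D.algClosed, D.large,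
    fun n m X hn hm => eq_of_isSmoothProjective D.C.toWeilCohomology hn hm⟩

/-- **Shadow 2 of the item**: an inner-form anchor of `A` yields (through `D.C`) "`deg` of a rationally
trivial zero-cycle is `0`" on every compact smooth projective variety over the anchor's residue field.
[folklore] -/
theorem finsum_residueDegree_eq_zero_of_innerFormAnchorsFor {A : AbelianVariety ℂ}
    (h : InnerFormAnchorsFor A) :
    ∃ (p : ℕ) (_ : Fact p.Prime) (k : Type) (_ : Field k) (_ : CharP k p) (_ : IsAlgClosed k),
      A.dim + 6 < p ∧ ∀ ⦃n : ℕ⦄ ⦃X : SchemeOver k⦄, IsSmoothProjective n X → ∀ [CompactSpace X.left]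
        (c : AlgebraicCycle X.left ℤ), c ∈ ratTrivial X.left 0 →
        ∑ᶠ z : X.left, (if Order.coheight z = (n : ℕ∞) then c z * (X.hom.residueDegree z : ℤ) else 0) = 0 := by
  obtain ⟨σ, 𝒳₀, S₀, f₀, t, s, eA, -, -, -, -, -, D, -, -⟩ := h
  exact ⟨D.p, D.prime, D.k, D.field, D.charP, D.algClosed, D.large,
    fun n X hX _ c hc => finsum_residueDegree_eq_zero_of_mem_ratTrivial D.C.toWeilCohomology hX c hc⟩

/-- **Shadow 1 of `InnerFormAnchors`** in arbitrarily large characteristic (abelian varieties of every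
dimension exist over `ℂ`, `exists_abelianVariety_dim_eq_succ`). [folklore] -/
theorem eq_of_isSmoothProjective_of_innerFormAnchors (h : Theses.SplitMonadSeeds.InnerFormAnchors)
    (g : ℕ) :
    ∃ (p : ℕ) (_ : Fact p.Prime) (k : Type) (_ : Field k) (_ : CharP k p) (_ : IsAlgClosed k),
      g + 7 < p ∧ ∀ ⦃n m : ℕ⦄ ⦃X : SchemeOver k⦄,
        IsSmoothProjective n X → IsSmoothProjective m X → n = m := by
  obtain ⟨A, hA⟩ := exists_abelianVariety_dim_eq_succ ℂ g
  obtain ⟨p, hp, k, hk, hc, hA', hlt, H⟩ := eq_of_isSmoothProjective_of_innerFormAnchorsFor (h A)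
  exact ⟨p, hp, k, hk, hc, hA', by omega, H⟩

end Summit.HodgeConjecture.HodgeConjecture.Theorems.SplitMonadSeeds.InnerFormAnchorsShadows

end
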